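import Summits.ValiantsHypothesis.ValiantsHypothesis.Theorems.NewtonUnitEquationsTwoProductsMomentRecordRungDefs
import Summits.ValiantsHypothesis.ValiantsHypothesis.Theorems.NewtonUnitEquationsTwoProductsMomentRecordOfLayerRecord

/-!
# R12 rung — RECORD LETTERS ARE FREE, part 1: the weak record lemma (K2, constant coefficients) and the record-letter bound (K1 = dim ℂ^{4m}), PROVED
# (crux `NewtonUnitEquations.TwoProducts` = stmt-ValiantsHypothesis-5906; Theorems-side TRANSPLANT of val-idea-37 g4's kernel-proved workfile)

TRANSPLANT NOTE.  §1, the first half of §2 (`pencilVec`, `oneVec`, `cost`, `WeakRecordLemma[Used]`) and the PROOF section of val-idea-37 g4's crux workfile `Cruxes/TwoProducts/RecordLettersFree_val_idea_37_g4.lean` rev 4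
@432a5af19a71 (sha16 4032ebb8ee1772ab; 0 `sorry`; std axioms; evidence #54 on 5906; crit-8 VERDICT #17 ★★) VERBATIM BY NAME; only changes: namespace
`ValIdea37g4` → `…TwoProducts.MomentRecord` (that of ✓ `…MomentRecordDefs` / ✓ `…MomentRecordRungDefs`, whose `pencil`, `IsRecord`, `layer`, `momentPoly`,
`size`, `wtZ`, `ptZ`, `wt` are used BY NAME), this header, one-line docstrings added where the scratch had none, the helper lemmas
`natDegree_momentPoly_le` / `layer_eq_zero_of_size_lt` CITED from ✓ `…MomentRecordOfLayerRecord` (p671707; same FQNs, one implicit-binder call adjusted)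
instead of re-declared, and the omission of the typed-only §3; the record-letter BOUND (`recordLetters`,
`RecordLetterBound[Used]`, `finrank_pencilSpace`, `…_of_weak`, `…_holds`) sits with the count in part 2 `…MomentRecordCount.lean` (400-line cap),
which imports this file and proves `momentRecordLawUsed_holds` / `momentRecordLaw_holds`.  Desk val-lit g14 RULING #356 (hand val-port-3 g3); `--supports
stmt-ValiantsHypothesis-5906` helper.  ALL CREDIT: val-idea-37 g4 (K2 lever lineage val-idea-34 g5 / 37 g3 / 35 g3; rung typing crit-8; Defs crit-8 / p3).

AUTHOR'S SUMMARY (abridged from the rev 4 module docstring): a CONSTANT-coefficient relation `γ_{·a} = μ·𝟙 + Σ_{b∈C} ν_b γ_{·b}` among letter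
pencils gives `layer k T = μ·layer k (T−e_a) + Σ_b ν_b·layer k (T−e_a+e_b)` at the SAME `k`; for a record `(S,k)` and `C` = carriers at most as costly
as `a` the right-hand pairs are shallow, different, not lighter, hence dead ⇒ `layer k S = 0`, contradiction.  Hence `WeakRecordLemmaUsed` (pencil
vector of each record carrier outside the ℂ-span of `𝟙` and the cheaper-or-tied carriers' pencil vectors; any real weight negative on USED base
letters, any `d ∈ ℤ²`, all layers) and `RecordLetterBoundUsed` (≤ `4m` record letters per weight, a dimension count).  VP ≠ VNP NOT proved.
-/

noncomputable section

open Classical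

-- single-conjunct layout: Sub = Summit, duplicated namespace component intended
set_option linter.dupNamespace false

namespace Summit.ValiantsHypothesis.ValiantsHypothesis.Theorems.NewtonUnitEquations.TwoProducts.MomentRecord

open scoped BigOperators
open Module Submodule
open Summit.ValiantsHypothesis.ValiantsHypothesis.Theorems.NewtonUnitEquations.TwoProducts.FormalLogLinearisation

variable {m n : ℕ}

/-! ## 1. The abstract greedy-record count (PROVED) -/

/-- **Greedy records are few.**  In a finite-dimensional space `W`, let `f : ι → W`, a distinguished vector `w₀`, a cost `key : ι → α`
into a linear order, and a finite set `Rec` such that every `a ∈ Rec` has `f a` outside the span of `w₀` and of the `f b` with `b ≠ a`,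
`key b ≤ key a`.  Then `#Rec + [w₀ ≠ 0] ≤ finrank W`. -/
theorem card_add_le_finrank_of_greedy {k W ι α : Type*} [DivisionRing k] [AddCommGroup W] [Module k W]
    [FiniteDimensional k W] [LinearOrder α] (key : ι → α) (f : ι → W) (w₀ : W) (Rec : Finset ι)
    (h : ∀ a ∈ Rec, f a ∉ span k (insert w₀ (f '' {b : ι | b ≠ a ∧ key b ≤ key a}))) :
    Rec.card + (if w₀ = 0 then 0 else 1) ≤ finrank k W := by
  classical
  -- motive: for `s ⊆ Rec`, `#s + [w₀ ≠ 0] ≤ finrank (span (insert w₀ (f '' s)))`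
  suffices H : ∀ s : Finset ι, s ⊆ Rec →
      s.card + (if w₀ = 0 then 0 else 1) ≤ finrank k (span k (insert w₀ (f '' (s : Set ι)))) by
    exact (H Rec le_rfl).trans (Submodule.finrank_le _)
  intro s
  induction s using Finset.induction_on_max_value key with
  | empty =>
    intro _
    by_cases hw : w₀ = 0
    · simp [hw]
    · have hins : (insert w₀ (f '' ((∅ : Finset ι) : Set ι))) = ({w₀} : Set W) := by
        rw [Finset.coe_empty, Set.image_empty, ← Set.singleton_def]
      rw [hins, finrank_span_singleton hw]
      simp [hw]
  | insert a s ha hkey ih =>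
    intro hsub
    have haRec : a ∈ Rec := hsub (Finset.mem_insert_self a s)
    have hsRec : s ⊆ Rec := fun x hx => hsub (Finset.mem_insert_of_mem hx)
    have ih' := ih hsRec
    -- `f a` is outside the smaller span
    set T : Submodule k W := span k (insert w₀ (f '' (s : Set ι))) with hT
    set T' : Submodule k W := span k (insert w₀ (f '' ((insert a s : Finset ι) : Set ι))) with hT'
    have hsubset : (f '' (s : Set ι)) ⊆ f '' {b : ι | b ≠ a ∧ key b ≤ key a} := by
      apply Set.image_mono
      intro x hx
      refine ⟨?_, hkey x hx⟩
      rintro rfl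
      exact ha hx
    have hfa : f a ∉ T := by
      intro hmem
      apply h a haRec
      exact Submodule.span_mono (Set.insert_subset_insert hsubset) hmem
    have hle : T ≤ T' := by
      apply Submodule.span_mono
      apply Set.insert_subset_insert
      apply Set.image_mono
      intro x hx
      simp only [Finset.coe_insert, Set.mem_insert_iff]
      exact Or.inr hx
    have hfa' : f a ∈ T' := by
      apply Submodule.subset_span
      apply Set.mem_insert_of_mem
      exact ⟨a, by simp, rfl⟩
    have hlt : T < T' := lt_of_le_of_ne hle (fun hEq => hfa (hEq ▸ hfa'))
    have hrank : finrank k T < finrank k T' := Submodule.finrank_lt_finrank_of_lt hlt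
    have hcard : (insert a s).card = s.card + 1 := Finset.card_insert_of_notMem ha
    rw [hcard]
    omega

/-- Corollary without the distinguished vector. -/
theorem card_le_finrank_of_greedy {k W ι α : Type*} [DivisionRing k] [AddCommGroup W] [Module k W]
    [FiniteDimensional k W] [LinearOrder α] (key : ι → α) (f : ι → W) (w₀ : W) (Rec : Finset ι)
    (h : ∀ a ∈ Rec, f a ∉ span k (insert w₀ (f '' {b : ι | b ≠ a ∧ key b ≤ key a}))) :
    Rec.card ≤ finrank k W :=
  le_trans (Nat.le_add_right _ _) (card_add_le_finrank_of_greedy key f w₀ Rec h)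

/-! ## 2. The weak record lemma, typed over the LANDED W3 vocabulary (`…TwoProducts.MomentRecord`, ✓ `MomentRecordDefs`) -/

/-- The PENCIL VECTOR of carrier `a`: for each signed term (`Sum.inl j` = side `u`, `Sum.inr j` = side `v`) the pair
`(coefficient of X^{x a}, coefficient of X^{x a + d}) = (α j a, β j a)`.  The pencil space `(Fin m ⊕ Fin m) → Fin 2 → ℂ` has dimension `4m`. -/
def pencilVec (α β α' β' : Fin m → Fin n → ℂ) (a : Fin n) : (Fin m ⊕ Fin m) → Fin 2 → ℂ :=
  Sum.elim (fun j => ![α j a, β j a]) (fun j => ![α' j a, β' j a])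

/-- The constant vector `𝟙` (the `1` of `log (1 + u_j)`), as a pencil vector. -/
def oneVec (m : ℕ) : (Fin m ⊕ Fin m) → Fin 2 → ℂ := fun _ => ![1, 0]

/-- The cost of carrier `a` for the weight `ξ` (positive when the carrier has negative weight). -/
def cost (ξ : Fin 2 → ℝ) (x : Fin n → Expo) (a : Fin n) : ℝ := - wt ξ (x a)

/-- **WEAK RECORD LEMMA** (sign-free, layer-free; paper proof in the header; PROVED below, `weakRecordLemma_holds`):
for every weight negative on the carriers and every W3-record `(S, k)` (any shallowness bound `m'`, any shift `d ∈ ℤ²`), every carrier `a`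
of `S` has its pencil vector outside the ℂ-span of `𝟙` and of the pencil vectors of the other carriers of cost `≤ cost a`. -/
def WeakRecordLemma : Prop :=
  ∀ (m n m' : ℕ) (α β α' β' : Fin m → Fin n → ℂ) (x : Fin n → Expo) (d : Fin 2 → ℤ) (ξ : Fin 2 → ℝ)
    (S : Fin n → ℕ) (k : ℕ),
    (∀ i, wt ξ (x i) < 0) → IsRecord α β α' β' x d m' ξ (S, k) →
    ∀ a : Fin n, 0 < S a →
      pencilVec α β α' β' a ∉
        Submodule.span ℂ (insert (oneVec m) (pencilVec α β α' β' '' {b : Fin n | b ≠ a ∧ cost ξ x b ≤ cost ξ x a}))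

/-- **WEAK RECORD LEMMA, used-letter form** (feeds crit-8's rung of record (A∘) `MomentRecordLawUsed`, W4 rev 2/3, whose weights are
negative only on letters that OCCUR — `NegWeightUsed`'s first clause is exactly the hypothesis here): same conclusion.  PROVED below
(`weakRecordLemmaUsed_holds`); NO orientation case `cost(d) ≥ 0 / ≤ 0` is needed (contrast W4 `RecordCarrierLocal`). -/
def WeakRecordLemmaUsed : Prop :=
  ∀ (m n m' : ℕ) (α β α' β' : Fin m → Fin n → ℂ) (x : Fin n → Expo) (d : Fin 2 → ℤ) (ξ : Fin 2 → ℝ)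
    (S : Fin n → ℕ) (k : ℕ),
    (∀ i, ((∃ j, α j i ≠ 0) ∨ ∃ j, α' j i ≠ 0) → wt ξ (x i) < 0) → IsRecord α β α' β' x d m' ξ (S, k) →
    ∀ a : Fin n, 0 < S a →
      pencilVec α β α' β' a ∉
        Submodule.span ℂ (insert (oneVec m) (pencilVec α β α' β' '' {b : Fin n | b ≠ a ∧ cost ξ x b ≤ cost ξ x a}))

/-- The used-letter form implies the all-carriers-negative form. -/
theorem weakRecordLemma_of_used (h : WeakRecordLemmaUsed) : WeakRecordLemma := by
  intro m n m' α β α' β' x d ξ S k hneg hrec a hSa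
  exact h m n m' α β α' β' x d ξ S k (fun i _ => hneg i) hrec a hSa

/-! ## 4. PROOF of the weak record lemma over the landed Defs (K2-const, kernel-checked) -/

section WeakProof

open Polynomial

/- the letter pencil `γ_{j a} = α_{j a} + X·β_{j a} ∈ ℂ[X]` is the LANDED `MomentRecord.pencil` (✓ `…MomentRecordRungDefs`, 22:21Z),
   same body as this file's rev 1–3 local def, which is therefore dropped. -/

/-- `momentPoly` is the sum over terms of the products of letter pencils (definitional). -/
theorem momentPoly_eq_pencil (α β : Fin m → Fin n → ℂ) (S : Fin n → ℕ) :
    momentPoly α β S = ∑ j, ∏ i, pencil α β j i ^ S i := rfl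

/-- A letter pencil has degree `≤ 1`. -/
theorem natDegree_pencil_le (α β : Fin m → Fin n → ℂ) (j : Fin m) (a : Fin n) :
    (pencil α β j a).natDegree ≤ 1 := by
  unfold pencil
  refine (natDegree_add_le _ _).trans (max_le (by simp) ?_)
  refine natDegree_mul_le.trans ?_
  simp

/-- Adding one letter `a` multiplies the product by the `a`-th factor. -/
theorem prod_pow_add_single (p : Fin n → ℂ[X]) (T : Fin n → ℕ) (a : Fin n) :
    ∏ i, p i ^ (T + Pi.single a 1 : Fin n → ℕ) i = p a * ∏ i, p i ^ T i := by
  simp only [Pi.add_apply, pow_add, Finset.prod_mul_distrib]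
  rw [mul_comm]
  congr 1
  rw [Finset.prod_eq_single a]
  · simp
  · intro b _ hb
    simp [hb]
  · intro h
    exact absurd (Finset.mem_univ a) h

/-- `momentPoly` of `T + e_a`, termwise. -/
theorem momentPoly_add_single (α β : Fin m → Fin n → ℂ) (T : Fin n → ℕ) (a : Fin n) :
    momentPoly α β (T + Pi.single a 1) = ∑ j, pencil α β j a * ∏ i, pencil α β j i ^ T i := by
  rw [momentPoly_eq_pencil]
  exact Finset.sum_congr rfl fun j _ => prod_pow_add_single (fun i => pencil α β j i) T a

/-- `size (T + e_b) = size T + 1`. -/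
theorem size_add_single (T : Fin n → ℕ) (b : Fin n) : size (T + Pi.single b 1) = size T + 1 := by
  simp [size, Finset.sum_add_distrib, Pi.single_apply]

/-- The weight of the point of `T + e_b` at layer `k` = that of `T` plus the weight of letter `b`. -/
theorem wtZ_ptZ_add_single (ξ : Fin 2 → ℝ) (x : Fin n → Expo) (d : Fin 2 → ℤ) (T : Fin n → ℕ) (b : Fin n) (k : ℕ) :
    wtZ ξ (ptZ x d (T + Pi.single b 1) k) = wtZ ξ (ptZ x d T k) + wt ξ (x b) := by
  have h : ∀ c, ptZ x d (T + Pi.single b 1) k c = ptZ x d T k c + ((x b c : ℕ) : ℤ) := by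
    intro c
    simp only [ptZ, Pi.add_apply, Nat.cast_add, add_mul, Finset.sum_add_distrib, Pi.single_apply, Nat.cast_ite,
      Nat.cast_one, Nat.cast_zero, ite_mul, one_mul, zero_mul, Finset.sum_ite_eq', Finset.mem_univ, if_true]
    ring
  simp only [wtZ, wt, h]
  push_cast
  ring

/-- (★) at the polynomial level: a CONSTANT relation among the pencils of carrier `a` and carriers `b ∈ Cs`
propagates to the moment polynomials of `T + e_a`, `T`, `T + e_b`. -/
theorem momentPoly_rel (α β : Fin m → Fin n → ℂ) (a : Fin n) (Cs : Finset (Fin n)) (μ : ℂ) (ν : Fin n → ℂ)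
    (hrel : ∀ j, pencil α β j a = C μ + ∑ b ∈ Cs, C (ν b) * pencil α β j b) (T : Fin n → ℕ) :
    momentPoly α β (T + Pi.single a 1) =
      C μ * momentPoly α β T + ∑ b ∈ Cs, C (ν b) * momentPoly α β (T + Pi.single b 1) := by
  simp_rw [momentPoly_add_single]
  rw [momentPoly_eq_pencil α β T, Finset.mul_sum]
  simp_rw [Finset.mul_sum]
  rw [Finset.sum_comm, ← Finset.sum_add_distrib]
  refine Finset.sum_congr rfl fun j _ => ?_
  rw [hrel j, add_mul, Finset.sum_mul]
  congr 1
  exact Finset.sum_congr rfl fun b _ => by ring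

/-- (★) at the layer level: SAME layer `k` on both sides, because the coefficients are constants. -/
theorem layer_rel (α β α' β' : Fin m → Fin n → ℂ) (a : Fin n) (Cs : Finset (Fin n)) (μ : ℂ) (ν : Fin n → ℂ)
    (hrel : ∀ j, pencil α β j a = C μ + ∑ b ∈ Cs, C (ν b) * pencil α β j b)
    (hrel' : ∀ j, pencil α' β' j a = C μ + ∑ b ∈ Cs, C (ν b) * pencil α' β' j b) (T : Fin n → ℕ) (k : ℕ) :
    layer α β α' β' k (T + Pi.single a 1) =
      μ * layer α β α' β' k T + ∑ b ∈ Cs, ν b * layer α β α' β' k (T + Pi.single b 1) := by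
  unfold layer
  rw [momentPoly_rel α β a Cs μ ν hrel T, momentPoly_rel α' β' a Cs μ ν hrel' T]
  simp only [coeff_sub, coeff_add, coeff_C_mul, finsetSum_coeff, mul_sub, Finset.sum_sub_distrib]
  ring

/-- **The weak record lemma holds, used-letter form** (K2 with constant coefficients; sign-free, layer-free, orientation-free). -/
theorem weakRecordLemmaUsed_holds : WeakRecordLemmaUsed := by
  intro m n m' α β α' β' x d ξ S k hneg hrec a hSa hmem
  -- 1. the constant relation `π_a = μ𝟙 + Σ_{b ∈ supp l} l_b π_b`
  rw [Submodule.mem_span_insert] at hmem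
  obtain ⟨μ, z, hz, hvec⟩ := hmem
  rw [Finsupp.mem_span_image_iff_linearCombination] at hz
  obtain ⟨l, hl, rfl⟩ := hz
  have hCs : ∀ b ∈ l.support, b ≠ a ∧ cost ξ x b ≤ cost ξ x a := by
    intro b hb
    have hsub : (↑l.support : Set (Fin n)) ⊆ {b : Fin n | b ≠ a ∧ cost ξ x b ≤ cost ξ x a} :=
      (Finsupp.mem_supported ℂ l).mp hl
    simpa using hsub (Finset.mem_coe.mpr hb)
  have hvec' : pencilVec α β α' β' a =
      μ • oneVec m + ∑ b ∈ l.support, l b • pencilVec α β α' β' b := by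
    rw [hvec, Finsupp.linearCombination_apply, Finsupp.sum]
  -- 2. row by row, as polynomial identities
  have hrow : ∀ j, pencil α β j a = C μ + ∑ b ∈ l.support, C (l b) * pencil α β j b := by
    intro j
    have h0 := congrFun (congrFun hvec' (Sum.inl j)) 0
    have h1 := congrFun (congrFun hvec' (Sum.inl j)) 1
    simp [pencilVec, oneVec] at h0 h1
    simp only [pencil, h0, h1, map_add, map_sum, map_mul]
    rw [Finset.mul_sum, add_assoc, ← Finset.sum_add_distrib]
    congr 1
    exact Finset.sum_congr rfl fun b _ => by ring
  have hrow' : ∀ j, pencil α' β' j a = C μ + ∑ b ∈ l.support, C (l b) * pencil α' β' j b := by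
    intro j
    have h0 := congrFun (congrFun hvec' (Sum.inr j)) 0
    have h1 := congrFun (congrFun hvec' (Sum.inr j)) 1
    simp [pencilVec, oneVec] at h0 h1
    simp only [pencil, h0, h1, map_add, map_sum, map_mul]
    rw [Finset.mul_sum, add_assoc, ← Finset.sum_add_distrib]
    congr 1
    exact Finset.sum_congr rfl fun b _ => by ring
  -- 3. `S = T + e_a`
  obtain ⟨T, rfl⟩ : ∃ T : Fin n → ℕ, S = T + Pi.single a 1 := by
    refine ⟨Function.update S a (S a - 1), funext fun i => ?_⟩
    by_cases hi : i = a
    · subst hi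
      simp [Nat.sub_add_cancel hSa]
    · simp [hi]
  -- the record, unpacked
  have hlive : (T + Pi.single a 1, k) ∈ live α β α' β' m' := hrec.1
  simp only [live, Set.mem_setOf_eq] at hlive
  obtain ⟨hsizeS, hkS, hlayerS⟩ := hlive
  rw [size_add_single] at hsizeS hkS
  have hbeat : ∀ q ∈ live α β α' β' m', q ≠ (T + Pi.single a 1, k) →
      wtZ ξ (ptZ x d q.1 q.2) < wtZ ξ (ptZ x d (T + Pi.single a 1) k) := hrec.2
  have key := layer_rel α β α' β' a l.support μ (⇑l) hrow hrow' T k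
  -- 4. the `𝟙`-term vanishes: either `x a` is a USED letter (negative weight ⇒ the competitor `(T, k)` is heavier ⇒ dead),
  --    or `a` and every cheaper-or-tied `b` are pure-shift carriers (`α = α' = 0` there) ⇒ `μ = 0` (resp. no rows at all when `m = 0`).
  have hμT : μ * layer α β α' β' k T = 0 := by
    by_cases hwa : wt ξ (x a) < 0
    · have hTa : layer α β α' β' k T = 0 := by
        by_contra hne
        have hkT : k ≤ size T := by
          by_contra hlt
          exact hne (layer_eq_zero_of_size_lt α β α' β' (not_le.mp hlt))
        have hq : (T, k) ∈ live α β α' β' m' := by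
          simp only [live, Set.mem_setOf_eq]
          exact ⟨by omega, hkT, hne⟩
        have hne' : (T, k) ≠ (T + Pi.single a 1, k) := by
          intro h
          have := congrFun (congrArg Prod.fst h) a
          simp at this
        have hlt := hbeat _ hq hne'
        dsimp only at hlt
        rw [wtZ_ptZ_add_single] at hlt
        linarith
      rw [hTa, mul_zero]
    · rcases Nat.eq_zero_or_pos m with hm | hm
      · subst hm
        simp [layer, momentPoly]
      · obtain ⟨j⟩ : Nonempty (Fin m) := ⟨⟨0, hm⟩⟩
        have hαa : α j a = 0 := by
          by_contra h
          exact hwa (hneg a (Or.inl ⟨j, h⟩))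
        have hαb : ∀ b ∈ l.support, l b * α j b = 0 := by
          intro b hb
          obtain ⟨hba, hcost⟩ := hCs b hb
          simp only [cost] at hcost
          have hwb : ¬ wt ξ (x b) < 0 := fun h => hwa (by linarith)
          have hb0 : α j b = 0 := by
            by_contra h
            exact hwb (hneg b (Or.inl ⟨j, h⟩))
          rw [hb0, mul_zero]
        have h0 := congrFun (congrFun hvec' (Sum.inl j)) 0
        simp [pencilVec, oneVec] at h0
        rw [hαa, Finset.sum_eq_zero hαb, add_zero] at h0
        rw [← h0, zero_mul]
  -- 5. the competitors `(T + e_b, k)`, `b` cheaper-or-tied, are dead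
  have hTb : ∀ b ∈ l.support, layer α β α' β' k (T + Pi.single b 1) = 0 := by
    intro b hb
    obtain ⟨hba, hcost⟩ := hCs b hb
    by_contra hne
    have hq : (T + Pi.single b 1, k) ∈ live α β α' β' m' := by
      simp only [live, Set.mem_setOf_eq, size_add_single]
      exact ⟨hsizeS, hkS, hne⟩
    have hne' : (T + Pi.single b 1, k) ≠ (T + Pi.single a 1, k) := by
      intro h
      have := congrFun (congrArg Prod.fst h) a
      simp [hba] at this
    have hlt := hbeat _ hq hne'
    dsimp only at hlt
    rw [wtZ_ptZ_add_single, wtZ_ptZ_add_single] at hlt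
    simp only [cost] at hcost
    linarith
  -- 6. hence `layer k S = 0`: contradiction with liveness of the record
  apply hlayerS
  rw [key, hμT, zero_add]
  exact Finset.sum_eq_zero fun b hb => by rw [hTb b hb, mul_zero]

/-- the all-carriers-negative form. -/
theorem weakRecordLemma_holds : WeakRecordLemma := weakRecordLemma_of_used weakRecordLemmaUsed_holds


end WeakProof

end Summit.ValiantsHypothesis.ValiantsHypothesis.Theorems.NewtonUnitEquations.TwoProducts.MomentRecord
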